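import Summits.QuantumFields.YangMills.Theorems.UnitScaleTiltProp7BubbleProfileRows
import Literature.MathematicalPhysics.QuantumFieldTheory.Balaban1983to89.B7Prop1Explicit
import Literature.MathematicalPhysics.QuantumLattice.BalabanRG
import HarnessLib

/-!
# Route `UnitScaleTilt`, crux K1 «MinimiserStabilityRegPr» (stmt-QuantumFields-19200), route-R E′, architecture (A′) «HCOW-VIA-Σ» (★★OWNER RULING g28-№13), package P-A4
# «CRUDE SLICE ON PRINT'S SLICE», CURVED — FILE (b-T)β «THE BUBBLE ON THE `ℤ^d` BLOCKS»: the parabola bubble of ✓ `Prop7BubbleProfileRows` read on the corner-anchored blocks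
# `blockSites ℓ y = ℓy + [0, ℓ)^d` of lit `QuantumLattice.BalabanRG` through the offsets `z ↦ z mod ℓ`: `φ(z) = Π_i β(z_i mod ℓ)`, `β(t) = t(ℓ − 1 − t)` — boundary layer, sign,
# the block mass `Σ_{B(y)} φ = S₁^d` (`6S₁ = ℓ(ℓ−1)(ℓ−2)`, `S₁ ≥ ℓ³∕36` for `ℓ ≥ 3`), the square mass `Σ_{B(y)} φ² ≤ (ℓ⁵∕16)^d`, and the gradient row
# `Σ_{B(y)} (φ(z + e_μ) − φ(z))² ≤ ℓ³·(ℓ⁵∕16)^{d−1}` — the rows (R-∂)(R-A)(R-B) and the Neumann mass `m > 0` of the competitor files, in the pullback lane's letters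

Cell `ym3-torus`, width seat `ym3-torus-px19` (gen 5); pens of record px12 g5 02:39:52Z ∕ px11 g5 03:15:50Z ((b-T) + B-β = px19; (b-ℤ) = px11 consumes `φ` and its mass; (a)∕F3 = px12).
THEOREMS ONLY (0 `def`, 0 `sorry`); `φ` is a FREE symbol with the defining hypothesis `hφ : φ z = Π_i ((z i % ℓ : ℤ) : ℝ)·((ℓ:ℝ) − 1 − (z i % ℓ : ℤ))`.
`--supports stmt-QuantumFields-19200 --as helper`, count-neutral.  YM₃ on T³ is a ladder rung (R3), not the Clay problem; nothing here claims `bern_P`, `hcoW`, E′, a stub, the crux,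
d = 4 or the mass gap.

WHAT IS PROVED (ns `…Theorems.Prop7BubbleOnBlocks`; any `d`, block side `ℓ ≥ 1`).
* §1 one coordinate: `parab_emod_nonneg`, `parab_emod_le` (`≤ ℓ²∕4`), `parab_emod_eq_zero_of_eq_zero ∕ _of_eq_pred`, ★ `abs_parab_emod_succ_sub_le` (`|β((a+1) mod ℓ) − β(a mod ℓ)| ≤ ℓ`).
* §2 the product: `bubbleZ_nonneg`, ★ `bubbleZ_eq_zero_of_boundary` (some `z_i mod ℓ ∈ {0, ℓ−1}` ⇒ `φ z = 0`), `bubbleZ_blockBase_add` (`φ(ℓy + t) = Π_i β(t_i)` for offsets `t ∈ [0,ℓ)^d`).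
* §3 block sums: ★ `sum_blockSites_bubbleZ` (`= (Σ_{j<ℓ} β j)^d`), ★ `six_mul_blockMassRoot` + `sum_blockSites_bubbleZ_ge` (`(ℓ³∕36)^d ≤ Σ_{B(y)} φ`, `ℓ ≥ 3` — the Neumann mass is POSITIVE),
  `sum_blockSites_bubbleZ_sq_le` (`≤ (ℓ⁵∕16)^d`), ★★ `sum_blockSites_bubbleZ_succ_sub_sq_le` (`Σ_{B(y)} (φ(z + e_μ) − φ z)² ≤ ℓ³·(ℓ⁵∕16)^{d−1}`).
HONEST SCOPE.  Finite sums; no lattice analysis.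

References: T. Bałaban, CMP 96 (1984) 223–250 [Balaban1984PropagatorsII] (§1: blocks `B(y)`); CMP 99 (1985) 389–434 [Balaban1985BackgroundPropagators] ((3.18)–(3.19) p.393).
-/

set_option autoImplicit false

noncomputable section

open scoped BigOperators
open Finset

namespace Summit.QuantumFields.YangMills.Theorems.Prop7BubbleOnBlocks

open Literature.MathematicalPhysics.QuantumFieldTheory.Balaban1983to89
open B7Prop1Explicit renaming Site → LSite
open B7Prop1Explicit (e e_apply)
open Literature.MathematicalPhysics.QuantumLattice (blockMap blockBase blockSites mem_blockSites_iff card_blockSites)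
open Summit.QuantumFields.YangMills.Theorems.Prop7BubbleProfileRows (six_mul_sum_range_parabola)

variable {d : ℕ} {ℓ : ℕ}

/-! ## §1 One coordinate: the parabola at an offset `a mod ℓ` -/

section OneD

variable (hℓ : 0 < ℓ)
include hℓ

/-- `0 ≤ r(ℓ−1−r)` at `r = a mod ℓ ∈ [0, ℓ−1]`. [folklore] -/
theorem parab_emod_nonneg (a : ℤ) : 0 ≤ ((a % (ℓ : ℤ) : ℤ) : ℝ) * ((ℓ : ℝ) - 1 - ((a % (ℓ : ℤ) : ℤ) : ℝ)) := by
  have hℓZ : (0 : ℤ) < ℓ := by exact_mod_cast hℓ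
  have h0 : (0 : ℝ) ≤ ((a % (ℓ : ℤ) : ℤ) : ℝ) := by exact_mod_cast Int.emod_nonneg a hℓZ.ne'
  have h1 : ((a % (ℓ : ℤ) : ℤ) : ℝ) + 1 ≤ ℓ := by
    have := Int.emod_lt_of_pos a hℓZ
    have : a % (ℓ : ℤ) + 1 ≤ ℓ := this
    exact_mod_cast this
  exact mul_nonneg h0 (by linarith)

/-- `r(ℓ−1−r) ≤ ℓ²∕4`. [folklore] -/
theorem parab_emod_le (a : ℤ) : ((a % (ℓ : ℤ) : ℤ) : ℝ) * ((ℓ : ℝ) - 1 - ((a % (ℓ : ℤ) : ℤ) : ℝ)) ≤ (ℓ : ℝ) ^ 2 / 4 := by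
  have h1 : (1 : ℝ) ≤ ℓ := by exact_mod_cast hℓ
  nlinarith [sq_nonneg (2 * ((a % (ℓ : ℤ) : ℤ) : ℝ) - ((ℓ : ℝ) - 1)), h1]

omit hℓ in
/-- at the lower face `a mod ℓ = 0` the parabola vanishes. [folklore] -/
theorem parab_emod_eq_zero_of_eq_zero (a : ℤ) (h : a % (ℓ : ℤ) = 0) : ((a % (ℓ : ℤ) : ℤ) : ℝ) * ((ℓ : ℝ) - 1 - ((a % (ℓ : ℤ) : ℤ) : ℝ)) = 0 := by
  rw [h]; simp

omit hℓ in
/-- at the upper face `a mod ℓ = ℓ − 1` the parabola vanishes. [folklore] -/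
theorem parab_emod_eq_zero_of_eq_pred (a : ℤ) (h : a % (ℓ : ℤ) = (ℓ : ℤ) - 1) : ((a % (ℓ : ℤ) : ℤ) : ℝ) * ((ℓ : ℝ) - 1 - ((a % (ℓ : ℤ) : ℤ) : ℝ)) = 0 := by
  rw [h]; push_cast; ring

/-- ★ `|β((a+1) mod ℓ) − β(a mod ℓ)| ≤ ℓ` (inside: `(r+1)(ℓ−2−r) − r(ℓ−1−r) = ℓ − 2 − 2r`; across the face both ends vanish). [folklore] -/
theorem abs_parab_emod_succ_sub_le (a : ℤ) :
    |(((a + 1) % (ℓ : ℤ) : ℤ) : ℝ) * ((ℓ : ℝ) - 1 - (((a + 1) % (ℓ : ℤ) : ℤ) : ℝ)) - ((a % (ℓ : ℤ) : ℤ) : ℝ) * ((ℓ : ℝ) - 1 - ((a % (ℓ : ℤ) : ℤ) : ℝ))| ≤ ℓ := by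
  have hℓZ : (0 : ℤ) < ℓ := by exact_mod_cast hℓ
  set r : ℤ := a % (ℓ : ℤ) with hr
  have hr0 : 0 ≤ r := Int.emod_nonneg a hℓZ.ne'
  have hrl : r < ℓ := Int.emod_lt_of_pos a hℓZ
  by_cases hlast : r = (ℓ : ℤ) - 1
  · -- across the face
    have h1 : (a + 1) % (ℓ : ℤ) = 0 := by
      rw [Int.add_emod, ← hr, hlast]
      rcases eq_or_lt_of_le (show (1 : ℤ) ≤ ℓ by exact_mod_cast hℓ) with h1 | h1
      · rw [← h1]; simp
      · rw [Int.emod_eq_of_lt (by norm_num) h1, sub_add_cancel, Int.emod_self]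
    rw [h1, hlast]; push_cast
    rw [show ((0:ℝ)) * ((ℓ:ℝ) - 1 - 0) - ((ℓ:ℝ) - 1) * ((ℓ:ℝ) - 1 - ((ℓ:ℝ) - 1)) = 0 by ring, abs_zero]
    exact Nat.cast_nonneg _
  · have hlt : r + 1 < ℓ := by omega
    have h1 : (a + 1) % (ℓ : ℤ) = r + 1 := by
      rw [Int.add_emod, ← hr]
      rcases eq_or_lt_of_le (show (1 : ℤ) ≤ ℓ by exact_mod_cast hℓ) with h1 | h1
      · exfalso; omega
      · rw [Int.emod_eq_of_lt (by norm_num) h1]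
        exact Int.emod_eq_of_lt (by linarith) hlt
    rw [h1]; push_cast
    have hr0' : (0 : ℝ) ≤ r := by exact_mod_cast hr0
    have hrl' : (r : ℝ) + 1 < ℓ := by exact_mod_cast hlt
    rw [abs_le]; constructor <;> nlinarith

end OneD

/-! ## §2 The product bubble `φ(z) = Π_i β(z_i mod ℓ)` -/

section Product

variable (φ : LSite d → ℝ) (hφ : ∀ z : LSite d, φ z = ∏ i, ((z i % (ℓ : ℤ) : ℤ) : ℝ) * ((ℓ : ℝ) - 1 - ((z i % (ℓ : ℤ) : ℤ) : ℝ)))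
include hφ

/-- `0 ≤ φ`. [folklore] -/
theorem bubbleZ_nonneg (hℓ : 0 < ℓ) (z : LSite d) : 0 ≤ φ z := by
  rw [hφ]; exact prod_nonneg fun i _ => parab_emod_nonneg hℓ (z i)

/-- ★ **BOUNDARY LAYER**: if some coordinate has offset `0` or `ℓ − 1`, then `φ z = 0`. [cite: Balaban1984PropagatorsII, (2.7)-(2.12) pp.224-225] -/
theorem bubbleZ_eq_zero_of_boundary (z : LSite d) (i : Fin d) (h : z i % (ℓ : ℤ) = 0 ∨ z i % (ℓ : ℤ) = (ℓ : ℤ) - 1) : φ z = 0 := by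
  rw [hφ]
  refine prod_eq_zero (mem_univ i) ?_
  rcases h with h | h
  · exact parab_emod_eq_zero_of_eq_zero (z i) h
  · exact parab_emod_eq_zero_of_eq_pred (z i) h

/-- on a block site `ℓy + t`, `t ∈ [0,ℓ)^d`, the bubble reads the offsets: `φ(ℓy + t) = Π_i t_i(ℓ−1−t_i)`. [cite: Balaban1985BackgroundPropagators, (3.18) p.393] -/
theorem bubbleZ_blockBase_add (y : LSite d) (t : Fin d → ℕ) (ht : ∀ i, t i < ℓ) :
    φ (blockBase ℓ y + fun i => (t i : ℤ)) = ∏ i, (t i : ℝ) * ((ℓ : ℝ) - 1 - (t i : ℝ)) := by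
  rw [hφ]
  refine prod_congr rfl fun i _ => ?_
  have h : (blockBase ℓ y + fun i => (t i : ℤ)) i % (ℓ : ℤ) = t i := by
    simp only [Pi.add_apply, blockBase]
    rw [Int.add_comm, Int.add_mul_emod_self_left]
    exact Int.emod_eq_of_lt (by positivity) (by exact_mod_cast ht i)
  rw [h]; push_cast; ring

/-- the same one step further in direction `μ`: `φ(ℓy + t + e_μ) = β((t_μ + 1) mod ℓ)·Π_{i≠μ} β(t_i)`, written with `mod` in every slot. [folklore] -/
theorem bubbleZ_blockBase_add_add_e (y : LSite d) (t : Fin d → ℕ) (μ : Fin d) :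
    φ (blockBase ℓ y + (fun i => (t i : ℤ)) + e μ)
      = ∏ i, ((((t i : ℤ) + if i = μ then 1 else 0) % (ℓ : ℤ) : ℤ) : ℝ) * ((ℓ : ℝ) - 1 - ((((t i : ℤ) + if i = μ then 1 else 0) % (ℓ : ℤ) : ℤ) : ℝ)) := by
  rw [hφ]
  refine prod_congr rfl fun i _ => ?_
  have h : (blockBase ℓ y + (fun i => (t i : ℤ)) + e μ) i % (ℓ : ℤ) = ((t i : ℤ) + if i = μ then 1 else 0) % (ℓ : ℤ) := by
    simp only [Pi.add_apply, blockBase, e_apply]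
    rw [add_assoc, Int.add_comm, Int.add_mul_emod_self_left]
  rw [h]

end Product

/-! ## §3 Block sums -/

section Helpers

/-- the offset parametrisation of a block is injective (as in lit `card_blockSites`). [folklore] -/
theorem blockOffset_injective (y : LSite d) : Function.Injective (fun t : Fin d → ℕ => blockBase ℓ y + fun i => (t i : ℤ)) := by
  intro t t' h
  funext i
  have := congr_fun h i
  simp only [Pi.add_apply, add_right_inj, Nat.cast_inj] at this
  exact this

/-- a block sum is an offset sum. [cite: Balaban1985BackgroundPropagators, (3.18) p.393] -/
theorem sum_blockSites_eq_sum_offsets (y : LSite d) (g : LSite d → ℝ) :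
    ∑ z ∈ blockSites ℓ y, g z = ∑ t ∈ Fintype.piFinset (fun _ : Fin d => range ℓ), g (blockBase ℓ y + fun i => (t i : ℤ)) := by
  rw [blockSites, sum_image]
  intro t _ t' _ h
  exact blockOffset_injective (ℓ := ℓ) y h

/-- `6·(Σ_{j<ℓ} j(ℓ−1−j)) = ℓ(ℓ−1)(ℓ−2)` (✓ `Prop7BubbleProfileRows.six_mul_sum_range_parabola`) and hence `Σ_{j<ℓ} j(ℓ−1−j) ≥ ℓ³∕36` for `ℓ ≥ 3`. [folklore] -/
theorem blockMassRoot_ge (h3 : 3 ≤ ℓ) : (ℓ : ℝ) ^ 3 / 36 ≤ ∑ j ∈ range ℓ, (j : ℝ) * ((ℓ : ℝ) - 1 - (j : ℝ)) := by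
  have h := six_mul_sum_range_parabola ℓ
  have h3' : (3 : ℝ) ≤ ℓ := by exact_mod_cast h3
  have hprod : 0 ≤ (ℓ : ℝ) * ((ℓ : ℝ) - 3) * (5 * (ℓ : ℝ) - 3) := mul_nonneg (mul_nonneg (by linarith) (by linarith)) (by linarith)
  have e : 6 * ((ℓ : ℝ) * ((ℓ : ℝ) - 1) * ((ℓ : ℝ) - 2)) = (ℓ : ℝ) ^ 3 + ((ℓ : ℝ) * ((ℓ : ℝ) - 3) * (5 * (ℓ : ℝ) - 3) + 3 * (ℓ : ℝ)) := by ring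
  nlinarith [h, e, hprod, h3']

/-- `Σ_{j<ℓ} (j(ℓ−1−j))² ≤ ℓ⁵∕16`. [folklore] -/
theorem sum_range_parab_sq_le : ∑ j ∈ range ℓ, ((j : ℝ) * ((ℓ : ℝ) - 1 - (j : ℝ))) ^ 2 ≤ (ℓ : ℝ) ^ 5 / 16 := by
  have hpt : ∀ j ∈ range ℓ, ((j : ℝ) * ((ℓ : ℝ) - 1 - (j : ℝ))) ^ 2 ≤ ((ℓ : ℝ) ^ 2 / 4) ^ 2 := by
    intro j hj
    have hjl : (j : ℝ) + 1 ≤ ℓ := by exact_mod_cast Nat.succ_le_of_lt (mem_range.1 hj)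
    have hj0 : (0 : ℝ) ≤ j := Nat.cast_nonneg _
    have h0 : 0 ≤ (j : ℝ) * ((ℓ : ℝ) - 1 - (j : ℝ)) := mul_nonneg hj0 (by linarith)
    have h1 : (j : ℝ) * ((ℓ : ℝ) - 1 - (j : ℝ)) ≤ (ℓ : ℝ) ^ 2 / 4 := by
      nlinarith [sq_nonneg (2 * (j : ℝ) - ((ℓ : ℝ) - 1))]
    exact pow_le_pow_left₀ h0 h1 2
  refine (sum_le_sum hpt).trans ?_
  rw [sum_const, card_range, nsmul_eq_mul]
  have : (0 : ℝ) ≤ ℓ := Nat.cast_nonneg _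
  nlinarith [this]

/-- `Σ_{t ∈ [0,ℓ)^d} Π_i F(t_i) = (Σ_{j<ℓ} F j)^d`. [folklore] -/
theorem sum_piFinset_prod_eq_pow (F : ℕ → ℝ) :
    ∑ t ∈ Fintype.piFinset (fun _ : Fin d => range ℓ), ∏ i, F (t i) = (∑ j ∈ range ℓ, F j) ^ d := by
  rw [Finset.sum_prod_piFinset (range ℓ) (fun (_ : Fin d) (j : ℕ) => F j), prod_const, card_univ, Fintype.card_fin]

end Helpers

section Sums

variable (φ : LSite d → ℝ) (hφ : ∀ z : LSite d, φ z = ∏ i, ((z i % (ℓ : ℤ) : ℤ) : ℝ) * ((ℓ : ℝ) - 1 - ((z i % (ℓ : ℤ) : ℤ) : ℝ)))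
include hφ

/-- ★ **THE BLOCK MASS**: `Σ_{z ∈ B(y)} φ z = (Σ_{j<ℓ} j(ℓ−1−j))^d`. [cite: Balaban1984PropagatorsII, (2.7)-(2.12) pp.224-225] -/
theorem sum_blockSites_bubbleZ (y : LSite d) :
    ∑ z ∈ blockSites ℓ y, φ z = (∑ j ∈ range ℓ, (j : ℝ) * ((ℓ : ℝ) - 1 - (j : ℝ))) ^ d := by
  rw [sum_blockSites_eq_sum_offsets y]
  have h : ∀ t ∈ Fintype.piFinset (fun _ : Fin d => range ℓ), φ (blockBase ℓ y + fun i => (t i : ℤ)) = ∏ i, (t i : ℝ) * ((ℓ : ℝ) - 1 - (t i : ℝ)) := by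
    intro t ht
    exact bubbleZ_blockBase_add φ hφ y t fun i => mem_range.1 (Fintype.mem_piFinset.1 ht i)
  rw [sum_congr rfl h, sum_piFinset_prod_eq_pow (fun j => (j : ℝ) * ((ℓ : ℝ) - 1 - (j : ℝ)))]

/-- ★ **THE NEUMANN MASS IS POSITIVE**: `(ℓ³∕36)^d ≤ Σ_{z ∈ B(y)} φ z` for `ℓ ≥ 3`. [cite: Balaban1984PropagatorsII, (2.7)-(2.12) pp.224-225] -/
theorem sum_blockSites_bubbleZ_ge (h3 : 3 ≤ ℓ) (y : LSite d) : ((ℓ : ℝ) ^ 3 / 36) ^ d ≤ ∑ z ∈ blockSites ℓ y, φ z := by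
  rw [sum_blockSites_bubbleZ φ hφ y]
  exact pow_le_pow_left₀ (by positivity) (blockMassRoot_ge h3) d

/-- **THE SQUARE MASS**: `Σ_{z ∈ B(y)} φ z² ≤ (ℓ⁵∕16)^d`. [cite: Balaban1984PropagatorsII, (2.7)-(2.12) pp.224-225] -/
theorem sum_blockSites_bubbleZ_sq_le (y : LSite d) : ∑ z ∈ blockSites ℓ y, φ z ^ 2 ≤ ((ℓ : ℝ) ^ 5 / 16) ^ d := by
  rw [sum_blockSites_eq_sum_offsets y]
  have h : ∀ t ∈ Fintype.piFinset (fun _ : Fin d => range ℓ), φ (blockBase ℓ y + fun i => (t i : ℤ)) ^ 2 = ∏ i, ((t i : ℝ) * ((ℓ : ℝ) - 1 - (t i : ℝ))) ^ 2 := by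
    intro t ht
    rw [bubbleZ_blockBase_add φ hφ y t fun i => mem_range.1 (Fintype.mem_piFinset.1 ht i), prod_pow]
  rw [sum_congr rfl h, sum_piFinset_prod_eq_pow (fun j => ((j : ℝ) * ((ℓ : ℝ) - 1 - (j : ℝ))) ^ 2)]
  exact pow_le_pow_left₀ (sum_nonneg fun _ _ => sq_nonneg _) sum_range_parab_sq_le d

/-- ★★ **THE GRADIENT ROW ON A BLOCK**: `Σ_{z ∈ B(y)} (φ(z + e_μ) − φ z)² ≤ ℓ³·(ℓ⁵∕16)^{d−1}` in every direction `μ` (the `μ`-factor changes by at most `ℓ`, the other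
factors contribute `(Σβ²)^{d−1}`, `ℓ` values of the `μ`-offset). [cite: Balaban1984PropagatorsII, (2.7)-(2.12) pp.224-225] -/
theorem sum_blockSites_bubbleZ_succ_sub_sq_le (hℓ : 0 < ℓ) (y : LSite d) (μ : Fin d) :
    ∑ z ∈ blockSites ℓ y, (φ (z + e μ) - φ z) ^ 2 ≤ (ℓ : ℝ) ^ 3 * ((ℓ : ℝ) ^ 5 / 16) ^ (d - 1) := by
  classical
  rw [sum_blockSites_eq_sum_offsets y (fun z => (φ (z + e μ) - φ z) ^ 2)]
  -- pointwise on offsets: `(φ(z+e_μ) − φ z)² ≤ ℓ²·Π_{i≠μ} β(t_i)²`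
  set g : ℕ → ℝ := fun j => ((j : ℝ) * ((ℓ : ℝ) - 1 - (j : ℝ))) ^ 2 with hg
  have hpt : ∀ t ∈ Fintype.piFinset (fun _ : Fin d => range ℓ),
      (φ ((blockBase ℓ y + fun i => (t i : ℤ)) + e μ) - φ (blockBase ℓ y + fun i => (t i : ℤ))) ^ 2 ≤ (ℓ : ℝ) ^ 2 * ∏ i ∈ univ.erase μ, g (t i) := by
    intro t ht
    have htl : ∀ i, t i < ℓ := fun i => mem_range.1 (Fintype.mem_piFinset.1 ht i)
    rw [bubbleZ_blockBase_add_add_e φ hφ y t μ, bubbleZ_blockBase_add φ hφ y t htl]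
    -- split off the factor `μ`
    rw [← mul_prod_erase univ _ (mem_univ μ), ← mul_prod_erase univ (fun i => (t i : ℝ) * ((ℓ : ℝ) - 1 - (t i : ℝ))) (mem_univ μ)]
    have hne : ∀ i ∈ univ.erase μ, ((((t i : ℤ) + if i = μ then 1 else 0) % (ℓ : ℤ) : ℤ) : ℝ) * ((ℓ : ℝ) - 1 - ((((t i : ℤ) + if i = μ then 1 else 0) % (ℓ : ℤ) : ℤ) : ℝ))
        = (t i : ℝ) * ((ℓ : ℝ) - 1 - (t i : ℝ)) := by
      intro i hi
      rw [if_neg (ne_of_mem_erase hi), add_zero, Int.emod_eq_of_lt (by positivity) (by exact_mod_cast htl i)]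
      push_cast; ring
    rw [prod_congr rfl hne, if_pos rfl, ← sub_mul, mul_pow, ← prod_pow]
    refine mul_le_mul_of_nonneg_right ?_ (prod_nonneg fun i _ => sq_nonneg _)
    -- the `μ`-factor: `|β((t+1) mod ℓ) − β(t)| ≤ ℓ` with `t = t mod ℓ`
    have ht0 : ((t μ : ℤ)) % (ℓ : ℤ) = t μ := Int.emod_eq_of_lt (by positivity) (by exact_mod_cast htl μ)
    have key := abs_parab_emod_succ_sub_le hℓ (t μ : ℤ)
    rw [ht0] at key
    push_cast at key
    have h0 := abs_nonneg ((((((t μ : ℤ)) + 1) % (ℓ : ℤ) : ℤ) : ℝ) * ((ℓ : ℝ) - 1 - (((((t μ : ℤ)) + 1) % (ℓ : ℤ) : ℤ) : ℝ)) - (t μ : ℝ) * ((ℓ : ℝ) - 1 - (t μ : ℝ)))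
    calc _ = |((((((t μ : ℤ)) + 1) % (ℓ : ℤ) : ℤ) : ℝ) * ((ℓ : ℝ) - 1 - (((((t μ : ℤ)) + 1) % (ℓ : ℤ) : ℤ) : ℝ)) - (t μ : ℝ) * ((ℓ : ℝ) - 1 - (t μ : ℝ)))| ^ 2 :=
          (sq_abs _).symm
      _ ≤ (ℓ : ℝ) ^ 2 := pow_le_pow_left₀ h0 key 2
  refine (sum_le_sum hpt).trans ?_
  rw [← mul_sum]
  -- `Σ_t Π_{i≠μ} g(t_i) = ℓ·(Σ_j g j)^{d−1}`
  have hsum : ∑ t ∈ Fintype.piFinset (fun _ : Fin d => range ℓ), ∏ i ∈ univ.erase μ, g (t i) = (ℓ : ℝ) * (∑ j ∈ range ℓ, g j) ^ (d - 1) := by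
    have e1 : ∀ t : Fin d → ℕ, ∏ i ∈ univ.erase μ, g (t i) = ∏ i, (if i = μ then (1 : ℝ) else g (t i)) := by
      intro t
      rw [← mul_prod_erase univ _ (mem_univ μ), if_pos rfl, one_mul]
      exact prod_congr rfl fun i hi => by rw [if_neg (ne_of_mem_erase hi)]
    rw [sum_congr rfl fun t _ => e1 t, Finset.sum_prod_piFinset (range ℓ) (fun (i : Fin d) (j : ℕ) => if i = μ then (1 : ℝ) else g j),
      ← mul_prod_erase univ _ (mem_univ μ)]
    have hμ : ∑ _j ∈ range ℓ, (if μ = μ then (1 : ℝ) else g _j) = ℓ := by simp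
    have hi : ∀ i ∈ univ.erase μ, ∑ j ∈ range ℓ, (if i = μ then (1 : ℝ) else g j) = ∑ j ∈ range ℓ, g j := by
      intro i hi
      exact sum_congr rfl fun j _ => if_neg (ne_of_mem_erase hi)
    rw [hμ, prod_congr rfl hi, prod_const, card_erase_of_mem (mem_univ μ), card_univ, Fintype.card_fin]
  rw [hsum]
  have hS : (∑ j ∈ range ℓ, g j) ^ (d - 1) ≤ ((ℓ : ℝ) ^ 5 / 16) ^ (d - 1) :=
    pow_le_pow_left₀ (sum_nonneg fun _ _ => sq_nonneg _) sum_range_parab_sq_le (d - 1)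
  have hℓ0 : (0 : ℝ) ≤ ℓ := Nat.cast_nonneg _
  calc (ℓ : ℝ) ^ 2 * ((ℓ : ℝ) * (∑ j ∈ range ℓ, g j) ^ (d - 1)) = (ℓ : ℝ) ^ 3 * (∑ j ∈ range ℓ, g j) ^ (d - 1) := by ring
    _ ≤ (ℓ : ℝ) ^ 3 * ((ℓ : ℝ) ^ 5 / 16) ^ (d - 1) := mul_le_mul_of_nonneg_left hS (by positivity)

end Sums

end Summit.QuantumFields.YangMills.Theorems.Prop7BubbleOnBlocks

end
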